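import Summits.KontsevichZagierPeriods.KontsevichZagierPeriods.Theorems.FurushoPentagonKernelModuloPeriodConjectureLeafWeightLeFifteen
import Summits.KontsevichZagierPeriods.KontsevichZagierPeriods.Theorems.FurushoPentagonKernelModuloPeriodConjectureLeafOfCheckBlocksGC
import Summits.KontsevichZagierPeriods.KontsevichZagierPeriods.Theorems.FurushoPentagonKernelModuloPeriodConjectureEdsBlockWeightSixteenA
import Summits.KontsevichZagierPeriods.KontsevichZagierPeriods.Theorems.FurushoPentagonKernelModuloPeriodConjectureEdsBlockWeightSixteenB
import Summits.KontsevichZagierPeriods.KontsevichZagierPeriods.Theorems.FurushoPentagonKernelModuloPeriodConjectureEdsBlockWeightSixteenC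
import Summits.KontsevichZagierPeriods.KontsevichZagierPeriods.Theorems.FurushoPentagonKernelModuloPeriodConjectureEdsBlockWeightSixteenD
import Summits.KontsevichZagierPeriods.KontsevichZagierPeriods.Theorems.FurushoPentagonKernelModuloPeriodConjectureEdsBlockWeightSixteenE
import Summits.KontsevichZagierPeriods.KontsevichZagierPeriods.Theorems.FurushoPentagonKernelModuloPeriodConjectureEdsBlockWeightSixteenF
import Summits.KontsevichZagierPeriods.KontsevichZagierPeriods.Theorems.FurushoPentagonKernelModuloPeriodConjectureEdsBlockWeightSixteenG
import HarnessLib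

/-!
# `KernelModuloPeriodConjecture`, line `Sketch`: Hoffman spanning for abstract associators, weight ≤ 16

Crux `FurushoPentagon.KernelModuloPeriodConjecture` (stmt-KontsevichZagierPeriods-15058), line
`Sketch`, lead c6. ONE citable theorem extending the weight `≤ 15` assembly
(`stub_associatorHoffmanSpanning_of_weight_le_15`) by weight `16`: for EVERY admissible index
`s` of weight `≤ 16` there is one finitely supported `b` on Hoffman indices of the same weight
with `c_{bw s}(φ) = Σ_t b_t c_{bw t}(φ)` at every group-like solution `φ` of Drinfeld's pentagon
over every commutative `ℚ`-algebra — the coordinate form of `GRT₁ ≅ U^{dR}_{MT(ℤ)}`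
(equivalently `𝔤𝔯𝔱₁ = 𝔤^𝔪`) in weights `≤ 16` for abstract associators, as a kernel-checked
theorem. Weight `16` (`2^14 − d₁₆ = 16347` non-Hoffman admissible words, `d₁₆ = 37`) is
Ihara–Kaneko–Zagier's linearised extended double shuffle system reduced mod 2 in SEVEN depth
blocks `(0,5]` (1471 columns), `(5,6]` (1987), `(6,7]` (2982), `(7,8]` (3431), `(8,9]` (3003),
`(9,10]` (2002), `(10,15]` (1471), with grouped rows where the plain rows of a depth prefix are
rank-deficient mod 2 and with COMPACTED slots (`LinEDS.checkBlockGC`: the rows XOR-folded into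
width `W' = 12287` resp. `10901`, on which the column codes have distinct residues) so that each
block is ONE kernel run inside the gate's elaboration slot; assembled by the compacted block
master `stub_leaf_of_checkBlocksGC`. For comparison, the printed verifications of IKZ's
Conjecture 1 are numerical (IKZ) or ranks of the EDS matrix of REAL multiple zeta values modulo a
large prime (Kaneko–Noro–Tsurumaki 2008, weight ≤ 20); here the statement is for every group-like
solution of the pentagon over every commutative `ℚ`-algebra and is checked by Lean's kernel.

References: K. Ihara, M. Kaneko, D. Zagier, Compos. Math. 142 (2006) §2, Conjecture 1
[IharaKanekoZagier2006]; M. Kaneko, M. Noro, K. Tsurumaki, IMA Vol. Math. Appl. 148 (2008)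
47–58; H. Furusho, Ann. of Math. 174 (2011) Thm 1.2 [Furusho2011]; F. Brown, Ann. of Math. 175
(2012) Thm 1.1 [Brown2012]; V. Drinfeld, Leningrad Math. J. 2 (1991).
-/

namespace Summit.KontsevichZagierPeriods.FurushoPentagon.KernelModuloPeriodConjecture

open Literature.NumberTheory.Transcendental

/-- Every column of weight `16` has depth at most `15` (closing the chain of the seven blocks). A
kernel computation. [folklore] -/
theorem depthCovered_16 : LinEDS.depthCovered 16 15 = true := by
  decide +kernel

/-- **The weight-16 slice of the algebraic leaf**: Hoffman spanning for every admissible index of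
weight `16` at every group-like pentagon solution, from the seven grouped, compacted depth-block
certificates `stub_edsBlockGC_16_0_5`, …, `stub_edsBlockGC_16_10_15` by the compacted block
master. [cite: IharaKanekoZagier2006, Conjecture 1] -/
theorem leafWeightSixteen (s : List ℕ) (hs : MZV.IsAdmissible s) (hw : MZV.weight s = 16) :
    ∃ b : List ℕ →₀ ℚ, (∀ t ∈ b.support, MZV.IsHoffman t ∧ MZV.weight t = MZV.weight s) ∧ ∀ (R : Type) [CommRing R] [Algebra ℚ R] [IsReduced R] (φ : NCSeries Bool R), NCSeries.IsGroupLike φ → NCSeries.DrinfeldPentagon φ → φ (MZV.binaryWord s) = b.sum (fun t q => q • φ (MZV.binaryWord t)) := by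
  refine stub_leaf_of_checkBlocksGC 16 [(0, 5), (5, 6), (6, 7), (7, 8), (8, 9), (9, 10), (10, 15)]
    (by norm_num) (List.cons_ne_nil _ _) (by decide) rfl (by decide) (fun p hp => ?_)
    (show LinEDS.depthCovered 16 15 = true from depthCovered_16) s hs hw
  simp only [List.mem_cons, List.not_mem_nil, or_false] at hp
  rcases hp with rfl | rfl | rfl | rfl | rfl | rfl | rfl
  · exact stub_edsBlockGC_16_0_5
  · exact stub_edsBlockGC_16_5_6
  · exact stub_edsBlockGC_16_6_7
  · exact stub_edsBlockGC_16_7_8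
  · exact stub_edsBlockGC_16_8_9
  · exact stub_edsBlockGC_16_9_10
  · exact stub_edsBlockGC_16_10_15

/-- **Registered stub `stub_associatorHoffmanSpanning_of_weight_le_16`** (lead c6; crux
stmt-KontsevichZagierPeriods-15058, line `Sketch`): the algebraic leaf `AssociatorHoffmanSpanning`
for every admissible index of weight at most `16` — weight `≤ 15` is the tree theorem
`stub_associatorHoffmanSpanning_of_weight_le_15`, weight `16` is `leafWeightSixteen`.
[cite: IharaKanekoZagier2006, Conjecture 1] -/
theorem stub_associatorHoffmanSpanning_of_weight_le_16 :
    ∀ s : List ℕ, MZV.IsAdmissible s → MZV.weight s ≤ 16 →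
      ∃ b : List ℕ →₀ ℚ, (∀ t ∈ b.support, MZV.IsHoffman t ∧ MZV.weight t = MZV.weight s) ∧ ∀ (R : Type) [CommRing R] [Algebra ℚ R] [IsReduced R] (φ : NCSeries Bool R), NCSeries.IsGroupLike φ → NCSeries.DrinfeldPentagon φ → φ (MZV.binaryWord s) = b.sum (fun t q => q • φ (MZV.binaryWord t)) := by
  intro s hs h16
  by_cases h15 : MZV.weight s ≤ 15
  · exact stub_associatorHoffmanSpanning_of_weight_le_15 s hs h15
  · exact leafWeightSixteen s hs (by omega)

end Summit.KontsevichZagierPeriods.FurushoPentagon.KernelModuloPeriodConjecture
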